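import Mathlib.Analysis.Calculus.BumpFunction.Normed
import Mathlib.Analysis.Calculus.BumpFunction.InnerProduct
import Mathlib.Analysis.Calculus.Deriv.Support
import Mathlib.Analysis.Normed.Group.Bounded
import Mathlib.MeasureTheory.Integral.Bochner.ContinuousLinearMap
import Mathlib.Data.Nat.Factorization.Basic
import Mathlib.Combinatorics.Enumerative.DoubleCounting
import Mathlib.Algebra.BigOperators.Intervals
import Literature.NumberTheory.Sieve.GrimmeltMerikoski2025
import HarnessLib

/-!
# Grimmelt–Merikoski 2025, Theorem 1.4: the printed range `K ≤ X²` is too large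

L. Grimmelt, J. Merikoski, *On the greatest prime factor and uniform equidistribution of quadratic
polynomials*, arXiv:2505.00493 (2025) [GrimmeltMerikoski2025], Theorem 1.4 (Type I estimate),
is vendored as printed in `GrimmeltMerikoski2025.lean` as the named fact
`grimmeltMerikoski2025_thm14` ("Let `1 ≤ D ≤ K ≤ X²` and `D ≤ X^{1/2}` …").  This file proves

* `grimmeltMerikoski2025_thm14_false : ¬ grimmeltMerikoski2025_thm14`,

i.e. the statement AS PRINTED is false at the edge `K = X²`, `D = 1` (`a = h = 1`).

## The counterexample

Take `X = 10m + 1/2`, `K = X²`, `D = 1`, `a = h = 1`, `ψ₁ ≥ 0` a smooth bump supported in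
`(1, 2)` with `ψ₁ = 1` on `[5/4, 7/4]`, and `ψ₂ ≥ 0` a smooth bump supported in `(-1, 1)` with
`ψ₂ = 1` on `[-1/2, 1/2]` (Mathlib's `ContDiffBump`; all derivatives are bounded, so the weights
are admissible for `X` large).  For `k` in the support of `ψ₁(k/K)` we have `k > K = X²`, while
`ψ₂(ℓ/X) ≠ 0` forces `|ℓ| ≤ 10m`, hence `0 < ℓ² + 1 ≤ 100m² + 1 < k`: NO such `k` divides any
`ℓ² + 1` in the window, every root sum vanishes identically, and the Type I form equals the full
main term
`X ∫ψ₂ · ∑_k ψ₁(k/K) ρ(k)/k ≥ (X/(162m²)) ∑_{128m²+32m+2 ≤ k ≤ 162m²} ρ(k) ≥ m/81`,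
because `∑ ρ(k)` over that range is at least the number of coprime pairs `(u, v) ∈ (8m, 9m]²`
(the map `(u,v) ↦ (u² + v², u·v⁻¹ mod u² + v²)` into pairs `(k, ν)` with `ν² + 1 ≡ 0 (mod k)` is
injective, by the Brahmagupta–Fibonacci identity), which is `≥ m²/5` for `m ≥ 340` by the
elementary sieve `#{gcd > 1} ≤ ∑_{d ≥ 2} (m/d + 1)²` with `∑_{d ≥ 2} 1/d² ≤ 2/3`.  The printed
right-hand side at these parameters is `X^ε · 2 X^{1/2} (1 + X/2)^{7/64} ≤ 2 X^{5/8}` (`ε = 1/64`),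
and `m/81 ≤ 2 (11m)^{5/8}` fails for `m ≥ 2^26`.

Numerically (mean of `ρ` is `3/(2π) ≈ 0.4775`): at `X = 1000.5`, `K = X²` the discrepancy is
`≈ 366` against a printed bound `≈ 125 · X^ε`; at `K = X^{1.85}` it is `≈ 145`; for
`K ≤ X^{1.7}` it is `≈ 1` (well inside the bound).

## Where the paper's argument does not cover the edge

§5 (proof of Theorem 1.4), first paragraph: "we may assume that `K ≤ DX^{1+η}` since otherwise the
claim is trivial by switching to the complementary divisor `m = (aℓ²+h)/k` and applying Poisson
summation on `ℓ` modulo `dm`."  After the switch, Poisson summation produces the main term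
`∑_m ρ(dm)/(dm) · g(m)` at scale `m ~ X²/K`, which agrees with the subtracted main term
`∑_k ψ₁(k/K) ρ(k) X ∫ψ₂ / k` only up to the mean-value error of `ρ_{a,h}` at scale `X²/K` — of
relative size `1` when `X²/K ≍ 1`.  The range the spectral argument of §5 actually treats,
`X^{1-o(1)} ≤ K ≤ D X^{1+o(1)}` (together with the genuinely trivial range `K ≤ X^{1-η}`), is
proposed separately as the named fact `grimmeltMerikoski2025_thm14_restricted` (extra hypothesis
`K ≤ D · X^{1+δ}`) next to the original in `GrimmeltMerikoski2025.lean`; the applications in the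
paper (Theorems 1.1–1.2, `K ≤ X^{1.312}`) only use that range.

## References

* [GrimmeltMerikoski2025] L. Grimmelt, J. Merikoski, arXiv:2505.00493v1, §1.1 Theorem 1.4 (p. 3)
  and §5, first paragraph (p. 13).
-/

noncomputable section

namespace Literature.NumberTheory.Sieve

open Finset Polynomial
open _root_.MeasureTheory
open scoped ContDiff

namespace GM2025

/-! ### Counting coprime pairs in a box -/

/-- An interval `(a, a + m]` of `m` consecutive naturals contains at most `m / d + 1` multiples
of `d`. [folklore] -/
theorem card_filter_dvd_Ioc_le (a m d : ℕ) :
    #((Ioc a (a + m)).filter (fun x : ℕ => d ∣ x)) ≤ m / d + 1 := by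
  have h1 : #((Ioc 0 (a + m)).filter (fun x : ℕ => d ∣ x)) = (a + m) / d :=
    Nat.Ioc_filter_dvd_card_eq_div _ _
  have h2 : #((Ioc 0 a).filter (fun x : ℕ => d ∣ x)) = a / d := Nat.Ioc_filter_dvd_card_eq_div _ _
  have hunion : (Ioc 0 (a + m)).filter (fun x : ℕ => d ∣ x) =
      (Ioc 0 a).filter (fun x : ℕ => d ∣ x) ∪ (Ioc a (a + m)).filter (fun x : ℕ => d ∣ x) := by
    rw [← filter_union, Ioc_union_Ioc_eq_Ioc (Nat.zero_le a) (Nat.le_add_right a m)]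
  have hdisj : Disjoint ((Ioc 0 a).filter (fun x : ℕ => d ∣ x))
      ((Ioc a (a + m)).filter (fun x : ℕ => d ∣ x)) :=
    disjoint_filter_filter (Ioc_disjoint_Ioc_of_le le_rfl)
  have hcard := card_union_of_disjoint hdisj
  rw [← hunion, h1, h2] at hcard
  have h3 : (a + m) / d ≤ a / d + m / d + 1 := by
    rcases Nat.eq_zero_or_pos d with hd | hd
    · subst hd; simp
    · rw [Nat.add_div hd]; split_ifs <;> omega
  omega

/-- `∑_{d=2}^{m} 1/d² ≤ 2/3 - 1/(m + 1/2)` (telescoping `1/d² ≤ 1/(d-1/2) - 1/(d+1/2)`). [folklore] -/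
theorem sum_Ioc_one_div_sq_le (m : ℕ) (hm : 1 ≤ m) :
    ∑ d ∈ Ioc 1 m, (1 : ℝ) / (d : ℝ) ^ 2 ≤ 2 / 3 - 1 / ((m : ℝ) + 1 / 2) := by
  induction m, hm using Nat.le_induction with
  | base => norm_num
  | succ n hn ih =>
    rw [sum_Ioc_succ_top hn, Nat.cast_succ]
    have hn0 : (1 : ℝ) ≤ n := by exact_mod_cast hn
    have key : (1 : ℝ) / ((n : ℝ) + 1) ^ 2 ≤ 1 / ((n : ℝ) + 1 / 2) - 1 / ((n : ℝ) + 1 + 1 / 2) := by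
      rw [div_sub_div _ _ (by positivity) (by positivity), div_le_div_iff₀ (by positivity) (by positivity)]
      nlinarith
    linarith

/-- `3 ∑_{d=2}^{m} ⌊m/d⌋² ≤ 2 m²`. [folklore] -/
theorem three_mul_sum_div_sq_le (m : ℕ) (hm : 1 ≤ m) :
    3 * ∑ d ∈ Ioc 1 m, (m / d) ^ 2 ≤ 2 * m ^ 2 := by
  have hreal : (3 : ℝ) * ∑ d ∈ Ioc 1 m, (((m / d : ℕ) : ℝ)) ^ 2 ≤ 2 * (m : ℝ) ^ 2 := by
    have hle : ∀ d ∈ Ioc 1 m, (((m / d : ℕ) : ℝ)) ^ 2 ≤ (m : ℝ) ^ 2 * (1 / (d : ℝ) ^ 2) := by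
      intro d hd
      have hd1 : (0 : ℝ) < d := by exact_mod_cast lt_trans Nat.zero_lt_one (mem_Ioc.mp hd).1
      have h := Nat.cast_div_le (m := m) (n := d) (α := ℝ)
      rw [mul_one_div, ← div_pow]
      exact pow_le_pow_left₀ (Nat.cast_nonneg _) h 2
    calc (3 : ℝ) * ∑ d ∈ Ioc 1 m, (((m / d : ℕ) : ℝ)) ^ 2
        ≤ 3 * ∑ d ∈ Ioc 1 m, (m : ℝ) ^ 2 * (1 / (d : ℝ) ^ 2) := by
          gcongr with d hd
          exact hle d hd
      _ = 3 * (m : ℝ) ^ 2 * ∑ d ∈ Ioc 1 m, 1 / (d : ℝ) ^ 2 := by rw [← mul_sum]; ring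
      _ ≤ 3 * (m : ℝ) ^ 2 * (2 / 3) := by
          gcongr
          have := sum_Ioc_one_div_sq_le m hm
          have h2 : (0 : ℝ) < 1 / ((m : ℝ) + 1 / 2) := by positivity
          linarith
      _ = 2 * (m : ℝ) ^ 2 := by ring
  exact_mod_cast hreal

/-- The number of coprime pairs in the box `(8m, 9m]²` is at least `m²/5` for `m ≥ 340`
(elementary sieve: remove, for every `d ≥ 2`, the pairs with `d ∣ u`, `d ∣ v`, using
`∑_{d ≥ 2} 1/d² < 3/4`). [folklore] -/
theorem coprime_box_card (m : ℕ) (hm : 340 ≤ m) :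
    m ^ 2 ≤ 5 * #(((Ioc (8 * m) (9 * m)) ×ˢ (Ioc (8 * m) (9 * m))).filter
      (fun p : ℕ × ℕ => Nat.Coprime p.1 p.2)) := by
  set B : Finset ℕ := Ioc (8 * m) (9 * m) with hB
  have hBcard : #B = m := by rw [hB, Nat.card_Ioc]; omega
  set P := B ×ˢ B with hP
  have hPcard : #P = m ^ 2 := by rw [hP, card_product, hBcard, sq]
  set NC := P.filter (fun p : ℕ × ℕ => ¬ Nat.Coprime p.1 p.2) with hNC
  have hsplit : #(P.filter (fun p : ℕ × ℕ => Nat.Coprime p.1 p.2)) + #NC = m ^ 2 := by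
    rw [hNC, card_filter_add_card_filter_not, hPcard]
  -- multiples of `d` in `B`
  have hBd : ∀ d : ℕ, #(B.filter (fun x : ℕ => d ∣ x)) ≤ m / d + 1 := by
    intro d
    have h := card_filter_dvd_Ioc_le (8 * m) m d
    have h89 : 8 * m + m = 9 * m := by ring
    rwa [h89] at h
  -- non-coprime pairs have a common divisor `d ∈ [2, 9m]`
  have hNCsub : NC ⊆ (Icc 2 (9 * m)).biUnion
      (fun d => (B.filter (fun x : ℕ => d ∣ x)) ×ˢ (B.filter (fun x : ℕ => d ∣ x))) := by
    intro p hp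
    rw [hNC, mem_filter, hP, mem_product] at hp
    obtain ⟨⟨hp1, hp2⟩, hcop⟩ := hp
    have hp1' := mem_Ioc.mp hp1
    have hp2' := mem_Ioc.mp hp2
    rw [mem_biUnion]
    refine ⟨Nat.gcd p.1 p.2, ?_, ?_⟩
    · rw [mem_Icc]
      constructor
      · have h0 : Nat.gcd p.1 p.2 ≠ 0 := by
          rw [Ne, Nat.gcd_eq_zero_iff]; omega
        have h1 : Nat.gcd p.1 p.2 ≠ 1 := hcop
        omega
      · exact (Nat.le_of_dvd (by omega) (Nat.gcd_dvd_left _ _)).trans hp1'.2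
    · rw [mem_product, mem_filter, mem_filter]
      exact ⟨⟨hp1, Nat.gcd_dvd_left _ _⟩, ⟨hp2, Nat.gcd_dvd_right _ _⟩⟩
  have hNCle : #NC ≤ ∑ d ∈ Icc 2 (9 * m), (m / d + 1) ^ 2 := by
    calc #NC ≤ #((Icc 2 (9 * m)).biUnion
          (fun d => (B.filter (fun x : ℕ => d ∣ x)) ×ˢ (B.filter (fun x : ℕ => d ∣ x)))) :=
          card_le_card hNCsub
      _ ≤ ∑ d ∈ Icc 2 (9 * m), #((B.filter (fun x : ℕ => d ∣ x)) ×ˢ (B.filter (fun x : ℕ => d ∣ x))) :=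
          card_biUnion_le
      _ ≤ ∑ d ∈ Icc 2 (9 * m), (m / d + 1) ^ 2 := by
          apply sum_le_sum
          intro d _
          rw [card_product, ← sq]
          exact Nat.pow_le_pow_left (hBd d) 2
  -- split the range of `d` at `m`
  have hIcc : Icc 2 (9 * m) = Ioc 1 m ∪ Ioc m (9 * m) := by
    rw [Ioc_union_Ioc_eq_Ioc (by omega) (by omega)]; rfl
  have hdisj2 : Disjoint (Ioc 1 m) (Ioc m (9 * m)) := Ioc_disjoint_Ioc_of_le le_rfl
  have hsum_split : ∑ d ∈ Icc 2 (9 * m), (m / d + 1) ^ 2 =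
      ∑ d ∈ Ioc 1 m, (m / d + 1) ^ 2 + ∑ d ∈ Ioc m (9 * m), (m / d + 1) ^ 2 := by
    rw [hIcc, sum_union hdisj2]
  have htail : ∑ d ∈ Ioc m (9 * m), (m / d + 1) ^ 2 = 8 * m := by
    have : ∀ d ∈ Ioc m (9 * m), (m / d + 1) ^ 2 = 1 := by
      intro d hd
      simp [Nat.div_eq_of_lt (mem_Ioc.mp hd).1]
    rw [sum_congr rfl this, sum_const, smul_eq_mul, mul_one, Nat.card_Ioc]; omega
  have hhead : 8 * ∑ d ∈ Ioc 1 m, (m / d + 1) ^ 2 ≤ 9 * ∑ d ∈ Ioc 1 m, (m / d) ^ 2 + 72 * m := by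
    have hpt : ∀ d ∈ Ioc 1 m, 8 * (m / d + 1) ^ 2 ≤ 9 * (m / d) ^ 2 + 72 := by
      intro d _
      have h : (8 : ℤ) * ((m / d : ℕ) + 1) ^ 2 ≤ 9 * ((m / d : ℕ) : ℤ) ^ 2 + 72 := by
        nlinarith [sq_nonneg (((m / d : ℕ) : ℤ) - 8)]
      exact_mod_cast h
    calc 8 * ∑ d ∈ Ioc 1 m, (m / d + 1) ^ 2 = ∑ d ∈ Ioc 1 m, 8 * (m / d + 1) ^ 2 := by
          rw [mul_sum]
      _ ≤ ∑ d ∈ Ioc 1 m, (9 * (m / d) ^ 2 + 72) := sum_le_sum hpt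
      _ = 9 * ∑ d ∈ Ioc 1 m, (m / d) ^ 2 + 72 * #(Ioc 1 m) := by
          rw [sum_add_distrib, ← mul_sum, sum_const, smul_eq_mul]; ring
      _ ≤ 9 * ∑ d ∈ Ioc 1 m, (m / d) ^ 2 + 72 * m := by
          rw [Nat.card_Ioc]
          have : m - 1 ≤ m := Nat.sub_le m 1
          nlinarith
  have h3 := three_mul_sum_div_sq_le m (by omega)
  -- assemble: 24 #NC ≤ 18 m² + 408 m
  have h24 : 24 * #NC ≤ 18 * m ^ 2 + 408 * m := by
    have := hNCle
    rw [hsum_split, htail] at this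
    nlinarith
  nlinarith

/-! ### Roots of `ν² + 1 ≡ 0 (mod k)` from coprime representations `k = u² + v²` -/

/-- `ρ_{1,1}(k)` is the number of `ν ∈ {0, …, k-1}` with `k ∣ ν² + 1`. [folklore] -/
theorem rho_one_one_eq_card (k : ℕ) :
    rho 1 1 k = #((range k).filter (fun n : ℕ => k ∣ n ^ 2 + 1)) := by
  simp only [rho, polyRootCountMod, Nat.cast_one, map_one, one_mul, Fin.prod_univ_one,
    Matrix.cons_val_fin_one, eval_add, eval_pow, eval_X, eval_one]
  congr 1
  ext n
  simp only [mem_filter, mem_range, and_congr_right_iff]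
  intro _
  norm_cast

/-- Brahmagupta–Fibonacci injectivity: two coprime positive representations `u² + v² = u'² + v'²`
of the same `k` defining the same root `ν` (i.e. `u ≡ ν v`, `u' ≡ ν v'` mod `k`) coincide.
[folklore] -/
theorem rep_unique {u v u' v' k ν : ℕ} (hu : 0 < u) (hv : 0 < v) (hu' : 0 < u') (hv' : 0 < v')
    (hk : u ^ 2 + v ^ 2 = k) (hk' : u' ^ 2 + v' ^ 2 = k) (hcop : Nat.Coprime u v)
    (hcop' : Nat.Coprime u' v') (h1 : u ≡ ν * v [MOD k]) (h2 : u' ≡ ν * v' [MOD k]) :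
    u = u' ∧ v = v' := by
  -- `u v' ≡ u' v (mod k)`
  have h3 : u * v' ≡ u' * v [MOD k] := by
    have e1 : u * v' ≡ ν * v * v' [MOD k] := h1.mul_right v'
    have e2 : u' * v ≡ ν * v' * v [MOD k] := h2.mul_right v
    have e3 : ν * v * v' = ν * v' * v := by ring
    rw [e3] at e1
    exact e1.trans e2.symm
  -- `|u v' - u' v| < k`
  have habs : |((u' * v : ℕ) : ℤ) - ((u * v' : ℕ) : ℤ)| < (k : ℤ) := by
    apply abs_lt_of_sq_lt_sq _ (by positivity)
    push_cast
    have hkz : ((u : ℤ) ^ 2 + (v : ℤ) ^ 2) * ((u' : ℤ) ^ 2 + (v' : ℤ) ^ 2) = (k : ℤ) ^ 2 := by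
      have e1 : (u : ℤ) ^ 2 + (v : ℤ) ^ 2 = k := by exact_mod_cast hk
      have e2 : (u' : ℤ) ^ 2 + (v' : ℤ) ^ 2 = k := by exact_mod_cast hk'
      rw [e1, e2, sq]
    have hpos : (0 : ℤ) < (u : ℤ) * u' + (v : ℤ) * v' := by positivity
    nlinarith
  have heq : u * v' = u' * v := h3.eq_of_abs_lt habs
  have hdvd1 : u ∣ u' := hcop.dvd_of_dvd_mul_right ⟨v', by rw [heq]⟩
  have hdvd2 : u' ∣ u := hcop'.dvd_of_dvd_mul_right ⟨v, heq⟩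
  have huu : u = u' := Nat.dvd_antisymm hdvd1 hdvd2
  subst huu
  refine ⟨rfl, ?_⟩
  have := Nat.eq_of_mul_eq_mul_left hu heq
  exact this.symm ▸ rfl

/-- The sum of `ρ_{1,1}(k)` over `k ∈ [128m² + 32m + 2, 162m²]` is at least the number of coprime
pairs in the box `(8m, 9m]²`: `(u, v) ↦ (u² + v², u·v⁻¹ mod (u² + v²))` is injective.
[folklore] -/
theorem coprime_box_le_sum_rho (m : ℕ) :
    #(((Ioc (8 * m) (9 * m)) ×ˢ (Ioc (8 * m) (9 * m))).filter
        (fun p : ℕ × ℕ => Nat.Coprime p.1 p.2)) ≤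
      ∑ k ∈ Icc (128 * m ^ 2 + 32 * m + 2) (162 * m ^ 2), rho 1 1 k := by
  simp_rw [rho_one_one_eq_card]
  rw [← card_sigma]
  apply card_le_card_of_forall_subsingleton
    (fun (p : ℕ × ℕ) (x : Σ _ : ℕ, ℕ) => p.1 ^ 2 + p.2 ^ 2 = x.1 ∧ p.1 ≡ x.2 * p.2 [MOD x.1])
  · -- existence of the root
    intro p hp
    rw [mem_filter, mem_product, mem_Ioc, mem_Ioc] at hp
    obtain ⟨⟨⟨hu1, hu2⟩, ⟨hv1, hv2⟩⟩, hcop⟩ := hp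
    set u := p.1 with hu
    set v := p.2 with hv
    set k := u ^ 2 + v ^ 2 with hk
    have hu0 : 0 < u := by omega
    have hv0 : 0 < v := by omega
    have hk0 : k ≠ 0 := by positivity
    have hvk : Nat.Coprime v k := by
      rw [hk, sq v, Nat.coprime_add_mul_right_right]
      exact (Nat.Coprime.pow_right 2 hcop.symm)
    obtain ⟨ν, hνk, hν⟩ := Nat.exists_mul_mod_eq_of_coprime u hvk hk0
    have hmod : u ≡ ν * v [MOD k] := by
      change u % k = (ν * v) % k
      rw [mul_comm, hν]
    refine ⟨⟨k, ν⟩, ?_, rfl, hmod⟩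
    rw [mem_sigma, mem_Icc, mem_filter, mem_range]
    refine ⟨⟨by nlinarith, by nlinarith⟩, hνk, ?_⟩
    -- `k ∣ ν² + 1`
    have h1 : (ν * v) ^ 2 + v ^ 2 ≡ u ^ 2 + v ^ 2 [MOD k] := (hmod.symm.pow 2).add_right _
    have h2 : (ν * v) ^ 2 + v ^ 2 ≡ 0 [MOD k] := by
      refine h1.trans ?_
      rw [← hk]
      exact Nat.modEq_zero_iff_dvd.mpr dvd_rfl
    have h3 : k ∣ (ν ^ 2 + 1) * v ^ 2 := by
      have := Nat.modEq_zero_iff_dvd.mp h2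
      convert this using 1; ring
    exact (Nat.Coprime.pow_right 2 hvk.symm).dvd_of_dvd_mul_right h3
  · -- injectivity
    intro x _ p hp p' hp'
    simp only [Set.mem_setOf_eq, mem_filter, mem_product, mem_Ioc] at hp hp'
    obtain ⟨⟨⟨⟨hu1, _⟩, ⟨hv1, _⟩⟩, hcop⟩, hk, hmod⟩ := hp
    obtain ⟨⟨⟨⟨hu1', _⟩, ⟨hv1', _⟩⟩, hcop'⟩, hk', hmod'⟩ := hp'
    obtain ⟨h1, h2⟩ := rep_unique (by omega) (by omega) (by omega) (by omega) hk hk' hcop hcop'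
      hmod hmod'
    exact Prod.ext h1 h2


/-! ### Smooth bumps as admissible weights -/

/-- A real bump function, viewed in `ℂ`, is smooth. [folklore] -/
theorem bump_complex_contDiff {c : ℝ} (f : ContDiffBump c) :
    ContDiff ℝ ∞ (fun u : ℝ => ((f u : ℝ) : ℂ)) :=
  Complex.ofRealCLM.contDiff.comp f.contDiff

/-- A real bump function, viewed in `ℂ`, has compact support. [folklore] -/
theorem bump_complex_hasCompactSupport {c : ℝ} (f : ContDiffBump c) :
    HasCompactSupport (fun u : ℝ => ((f u : ℝ) : ℂ)) :=
  f.hasCompactSupport.comp_left Complex.ofReal_zero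

/-- Iterated derivatives of a compactly supported function are compactly supported. [folklore] -/
theorem hasCompactSupport_iteratedDeriv {ψ : ℝ → ℂ} (hψ : HasCompactSupport ψ) (j : ℕ) :
    HasCompactSupport (iteratedDeriv j ψ) := by
  induction j with
  | zero => rwa [iteratedDeriv_zero]
  | succ j ih => rw [iteratedDeriv_succ]; exact ih.deriv

/-- Each iterated derivative of a bump is bounded. [folklore] -/
theorem bump_complex_iteratedDeriv_bounded {c : ℝ} (f : ContDiffBump c) (j : ℕ) :
    ∃ C : ℝ, ∀ u : ℝ, ‖iteratedDeriv j (fun u : ℝ => ((f u : ℝ) : ℂ)) u‖ ≤ C :=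
  ((bump_complex_contDiff f).continuous_iteratedDeriv j (mod_cast le_top)).bounded_above_of_compact_support
    (hasCompactSupport_iteratedDeriv (bump_complex_hasCompactSupport f) j)

/-- A bump `f` around `c` with outer radius `r` is, for every order `J`, an admissible weight on
`[c - r, c + r]` with derivative bound any `B ≥ C(f, J)`. [folklore] -/
theorem bump_complex_admissible {c : ℝ} (f : ContDiffBump c) (J : ℕ) :
    ∃ C : ℝ, 0 ≤ C ∧ ∀ B : ℝ, C ≤ B →
      IsAdmissibleWeight (fun u : ℝ => ((f u : ℝ) : ℂ)) (c - f.rOut) (c + f.rOut) J B := by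
  choose C hC using bump_complex_iteratedDeriv_bounded f
  refine ⟨∑ j ∈ range (J + 1), |C j|, sum_nonneg (fun j _ => abs_nonneg _), fun B hB =>
    ⟨bump_complex_contDiff f, ?_, ?_⟩⟩
  · intro u hu
    have hu' : f u ≠ 0 := fun h => hu (by simp [h])
    have hmem : u ∈ Function.support f := hu'
    rw [f.support_eq, Metric.mem_ball, Real.dist_eq] at hmem
    obtain ⟨h1, h2⟩ := abs_lt.mp hmem
    constructor <;> linarith
  · intro j hj u
    calc ‖iteratedDeriv j (fun u : ℝ => ((f u : ℝ) : ℂ)) u‖ ≤ C j := hC j u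
      _ ≤ |C j| := le_abs_self _
      _ ≤ ∑ i ∈ range (J + 1), |C i| :=
          single_le_sum (f := fun i => |C i|) (fun i _ => abs_nonneg _)
            (mem_range.mpr (Nat.lt_succ_of_le hj))
      _ ≤ B := hB

/-! ### The counterexample: `X = 10m + 1/2`, `K = X²`, `D = 1`, `a = h = 1` -/

/-- Lower bound for the Type I form at the counterexample parameters: with `ψ₁` a bump equal to
`1` on `[5/4, 7/4]` and supported in `(1, 2)`, `ψ₂` a bump equal to `1` on `[-1/2, 1/2]` and
supported in `(-1, 1)`, `X = 10m + 1/2`, `K = X²`, `D = 1`: every root sum vanishes (for `k > K`,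
`k ∣ ℓ² + 1` forces `|ℓ| > 10m`, where `ψ₂(ℓ/X) = 0`), so the Type I form equals the full main
term `X ∫ψ₂ · ∑_k ψ₁(k/K) ρ(k)/k ≥ m/81`. [folklore] -/
theorem typeISum_counterexample_lower (b₁ : ContDiffBump ((3 : ℝ) / 2)) (hb₁ : b₁.rIn = 1 / 4)
    (hb₁' : b₁.rOut = 1 / 2) (b₂ : ContDiffBump (0 : ℝ)) (hb₂ : b₂.rIn = 1 / 2) (hb₂' : b₂.rOut = 1)
    (m : ℕ) (hm : 340 ≤ m) :
    (m : ℝ) / 81 ≤ typeISum 1 1 (fun u => ((b₁ u : ℝ) : ℂ)) (fun u => ((b₂ u : ℝ) : ℂ))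
      (10 * m + 1 / 2) ((10 * m + 1 / 2) ^ 2) 1 := by
  set X : ℝ := 10 * m + 1 / 2 with hX
  set K : ℝ := X ^ 2 with hK
  set ψ₁ : ℝ → ℂ := fun u => ((b₁ u : ℝ) : ℂ) with hψ₁
  set ψ₂ : ℝ → ℂ := fun u => ((b₂ u : ℝ) : ℂ) with hψ₂
  have hm1 : (1 : ℝ) ≤ m := by exact_mod_cast le_trans (by norm_num) hm
  have hX0 : 0 < X := by rw [hX]; positivity
  have hK0 : 0 < K := by rw [hK]; positivity
  -- Step 1: the Type I form at `D = 1`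
  have hT : typeISum 1 1 ψ₁ ψ₂ X K 1 =
      ‖∑ k ∈ Icc 1 ⌊2 * K⌋₊, ψ₁ ((k : ℝ) / K) * rootDiscrepancy 1 1 k ψ₂ X‖ := by
    simp only [typeISum, Nat.floor_one, Icc_self, sum_singleton]
    rw [filter_true_of_mem (fun k _ => one_dvd k)]
  -- Step 2: the root sums vanish against `ψ₁(k/K)`
  have hvanish : ∀ k ∈ Icc 1 ⌊2 * K⌋₊, ψ₁ ((k : ℝ) / K) * rootSum 1 1 k ψ₂ X = 0 := by
    intro k _
    by_cases hb : b₁ ((k : ℝ) / K) = 0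
    · simp [hψ₁, hb]
    · have hsupp : (k : ℝ) / K ∈ Function.support b₁ := hb
      rw [b₁.support_eq, Metric.mem_ball, Real.dist_eq, hb₁'] at hsupp
      have hkK : K < k := by
        have h1 : 1 < (k : ℝ) / K := by linarith [(abs_lt.mp hsupp).1]
        rwa [lt_div_iff₀ hK0, one_mul] at h1
      have hrs : rootSum 1 1 k ψ₂ X = 0 := by
        apply sum_eq_zero
        intro ℓ hℓ
        rw [mem_filter] at hℓ
        obtain ⟨_, hdvd⟩ := hℓ
        simp only [Nat.cast_one, one_mul] at hdvd
        by_contra hne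
        have hb2 : b₂ ((ℓ : ℝ) / X) ≠ 0 := fun h => hne (by simp [hψ₂, h])
        have hsupp2 : (ℓ : ℝ) / X ∈ Function.support b₂ := hb2
        rw [b₂.support_eq, Metric.mem_ball, Real.dist_eq, sub_zero, hb₂', abs_div, abs_of_pos hX0,
          div_lt_one hX0] at hsupp2
        have habs : |ℓ| ≤ 10 * (m : ℤ) := by
          have h1 : ((|ℓ| : ℤ) : ℝ) < ((10 * (m : ℤ) + 1 : ℤ) : ℝ) := by
            rw [Int.cast_abs]; push_cast; linarith
          have h2 : |ℓ| < 10 * (m : ℤ) + 1 := by exact_mod_cast h1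
          omega
        have hsq : ℓ ^ 2 ≤ (10 * (m : ℤ)) ^ 2 := by
          calc ℓ ^ 2 = |ℓ| ^ 2 := (sq_abs ℓ).symm
            _ ≤ (10 * (m : ℤ)) ^ 2 := pow_le_pow_left₀ (abs_nonneg ℓ) habs 2
        have hle : (k : ℤ) ≤ ℓ ^ 2 + 1 := Int.le_of_dvd (by positivity) hdvd
        have hle' : (k : ℝ) ≤ 100 * (m : ℝ) ^ 2 + 1 := by
          have : (k : ℤ) ≤ 100 * (m : ℤ) ^ 2 + 1 := by nlinarith
          exact_mod_cast this
        have : K < 100 * (m : ℝ) ^ 2 + 1 := hkK.trans_le hle'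
        rw [hK, hX] at this
        nlinarith
      rw [hrs, mul_zero]
  -- Step 3: the inner sum is (minus) a real number `R`
  set I : ℝ := ∫ u, b₂ u with hI
  have hint : ∫ u, ψ₂ u = (I : ℂ) := integral_complex_ofReal
  set S : Finset ℕ := Icc 1 ⌊2 * K⌋₊ with hS
  set R : ℝ := ∑ k ∈ S, b₁ ((k : ℝ) / K) * ((rho 1 1 k : ℝ) / k * X * I) with hR
  have hinner : ∑ k ∈ S, ψ₁ ((k : ℝ) / K) * rootDiscrepancy 1 1 k ψ₂ X = -(R : ℂ) := by
    rw [hR, Complex.ofReal_sum, ← sum_neg_distrib]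
    apply sum_congr rfl
    intro k hk
    rw [rootDiscrepancy, mul_sub, hvanish k hk, zero_sub, hint]
    simp only [hψ₁]
    push_cast
    ring
  -- Step 4: `R ≥ m / 81`
  have hI1 : 1 ≤ I := by
    have := b₂.measure_closedBall_le_integral volume
    rw [Real.volume_real_closedBall b₂.rIn_pos.le, hb₂] at this
    linarith
  have hRT : R = X * I * ∑ k ∈ S, b₁ ((k : ℝ) / K) * ((rho 1 1 k : ℝ) / k) := by
    rw [hR, mul_sum]
    apply sum_congr rfl
    intro k _
    ring
  set I' : Finset ℕ := Icc (128 * m ^ 2 + 32 * m + 2) (162 * m ^ 2) with hI'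
  have hsub : I' ⊆ S := by
    intro k hk
    rw [hI', mem_Icc] at hk
    rw [hS, mem_Icc]
    refine ⟨by omega, Nat.le_floor ?_⟩
    have : (k : ℝ) ≤ 162 * (m : ℝ) ^ 2 := by exact_mod_cast hk.2
    rw [hK, hX]
    nlinarith
  have hone : ∀ k ∈ I', b₁ ((k : ℝ) / K) = 1 := by
    intro k hk
    rw [hI', mem_Icc] at hk
    apply b₁.one_of_mem_closedBall
    rw [Metric.mem_closedBall, Real.dist_eq, hb₁, abs_le]
    have hk1 : ((128 * m ^ 2 + 32 * m + 2 : ℕ) : ℝ) ≤ k := by exact_mod_cast hk.1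
    have hk2 : (k : ℝ) ≤ ((162 * m ^ 2 : ℕ) : ℝ) := by exact_mod_cast hk.2
    push_cast at hk1 hk2
    constructor
    · rw [le_sub_iff_add_le, le_div_iff₀ hK0, hK, hX]
      nlinarith
    · rw [sub_le_iff_le_add, div_le_iff₀ hK0, hK, hX]
      nlinarith
  have hTsum : (1 : ℝ) / 810 ≤ ∑ k ∈ S, b₁ ((k : ℝ) / K) * ((rho 1 1 k : ℝ) / k) := by
    have hm0 : (0 : ℝ) < m := by linarith
    calc (1 : ℝ) / 810 ≤ (∑ k ∈ I', (rho 1 1 k : ℝ)) / (162 * (m : ℝ) ^ 2) := by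
          rw [div_le_div_iff₀ (by norm_num) (by positivity)]
          have h1 := coprime_box_card m hm
          have h2 := coprime_box_le_sum_rho m
          have h3 : (m : ℝ) ^ 2 ≤ 5 * ∑ k ∈ I', (rho 1 1 k : ℝ) := by
            have : m ^ 2 ≤ 5 * ∑ k ∈ I', rho 1 1 k := h1.trans (Nat.mul_le_mul_left 5 h2)
            exact_mod_cast this
          nlinarith
      _ = ∑ k ∈ I', (rho 1 1 k : ℝ) / (162 * (m : ℝ) ^ 2) := by rw [sum_div]
      _ ≤ ∑ k ∈ I', b₁ ((k : ℝ) / K) * ((rho 1 1 k : ℝ) / k) := by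
          apply sum_le_sum
          intro k hk
          rw [hone k hk, one_mul]
          have hk' := mem_Icc.mp hk
          have hk2 : (k : ℝ) ≤ ((162 * m ^ 2 : ℕ) : ℝ) := by exact_mod_cast hk'.2
          have hk1 : ((128 * m ^ 2 + 32 * m + 2 : ℕ) : ℝ) ≤ k := by exact_mod_cast hk'.1
          push_cast at hk1 hk2
          have hk0 : (0 : ℝ) < k := by nlinarith
          exact div_le_div_of_nonneg_left (Nat.cast_nonneg _) hk0 hk2
      _ ≤ ∑ k ∈ S, b₁ ((k : ℝ) / K) * ((rho 1 1 k : ℝ) / k) :=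
          sum_le_sum_of_subset_of_nonneg hsub
            (fun k _ _ => mul_nonneg b₁.nonneg (div_nonneg (Nat.cast_nonneg _) (Nat.cast_nonneg _)))
  have hRge : (m : ℝ) / 81 ≤ R := by
    rw [hRT]
    have hX10 : (10 : ℝ) * m ≤ X := by rw [hX]; linarith
    calc (m : ℝ) / 81 = 10 * (m : ℝ) * 1 * (1 / 810) := by ring
      _ ≤ X * I * ∑ k ∈ S, b₁ ((k : ℝ) / K) * ((rho 1 1 k : ℝ) / k) := by
          gcongr
  -- Step 5: conclude
  rw [hT, hinner, norm_neg, Complex.norm_real, Real.norm_eq_abs]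
  exact hRge.trans (le_abs_self R)

end GM2025

open GM2025

/-- **Theorem 1.4 of [GrimmeltMerikoski2025] is false as printed** (at the edge `K = X²` of the
printed range `1 ≤ D ≤ K ≤ X²`).  Counterexample: `ε = 1/64`; given `δ, J, X₀` take
`X = 10m + 1/2` (`m` large), `K = X²`, `D = 1`, `a = h = 1`, `ψ₁ ≥ 0` a bump supported in
`(1,2)` and equal to `1` on `[5/4, 7/4]`, `ψ₂ ≥ 0` a bump supported in `(-1,1)`, equal to `1` on
`[-1/2, 1/2]`.  For `k ≥ K = X²` no `ℓ` with `ψ₂(ℓ/X) ≠ 0` (so `|ℓ| ≤ 10m`) has `k ∣ ℓ² + 1`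
(`0 < ℓ² + 1 ≤ 100m² + 1 < k`), so every root sum vanishes and the Type I form equals the full
main term `X ∫ψ₂ ∑_k ψ₁(k/K) ρ(k)/k ≥ (X/(2K)) ∑_{5K/4 ≤ k ≤ 7K/4} ρ(k) ≥ m/81`, using
`∑_{k ∈ [128m²+32m+2, 162m²]} ρ(k) ≥ #{coprime (u,v) ∈ (8m,9m]²} ≥ m²/5` (the roots
`u v⁻¹ mod u² + v²`); whereas the printed bound is
`X^{1/64} · 2X^{1/2}(1 + X/2)^{7/64} ≤ 2X^{5/8} ≤ 2(11m)^{5/8} < m/81` for `m ≥ 2^26`.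
(The gap in the paper: §5, first paragraph, "we may assume `K ≤ DX^{1+η}` since otherwise the
claim is trivial by switching to the complementary divisor" — after switching, the Poisson main
term matches the stated one only up to the mean-value error of `ρ_{a,h}` at scale `X²/K`, which is
of full size when `X²/K ≍ 1`.  The range the proof treats, `K ≤ D X^{1+o(1)}`, is proposed
separately as `grimmeltMerikoski2025_thm14_restricted` in `GrimmeltMerikoski2025.lean`.)
[folklore] -/
theorem grimmeltMerikoski2025_thm14_false : ¬ grimmeltMerikoski2025_thm14 := by
  intro H
  obtain ⟨δ, hδ, J, X₀, H⟩ := H (1 / 64) (by norm_num)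
  let b₁ : ContDiffBump ((3 : ℝ) / 2) := ⟨1 / 4, 1 / 2, by norm_num, by norm_num⟩
  let b₂ : ContDiffBump (0 : ℝ) := ⟨1 / 2, 1, by norm_num, by norm_num⟩
  obtain ⟨C₁, hC₁0, hC₁⟩ := bump_complex_admissible b₁ J
  obtain ⟨C₂, hC₂0, hC₂⟩ := bump_complex_admissible b₂ J
  -- a large parameter `m`
  set A : ℝ := (C₁ + C₂ + 1) ^ (1 / δ) with hA
  obtain ⟨m, hm340, hm26, hmX₀, hmA⟩ : ∃ m : ℕ, 340 ≤ m ∧ 2 ^ 26 ≤ m ∧ X₀ ≤ m ∧ A ≤ m := by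
    refine ⟨max (2 ^ 26) (max ⌈X₀⌉₊ ⌈A⌉₊), le_trans (by norm_num) (le_max_left _ _),
      le_max_left _ _, ?_, ?_⟩
    · calc X₀ ≤ ⌈X₀⌉₊ := Nat.le_ceil _
        _ ≤ _ := by exact_mod_cast (le_max_left _ _).trans (le_max_right (2 ^ 26) _)
    · calc A ≤ ⌈A⌉₊ := Nat.le_ceil _
        _ ≤ _ := by exact_mod_cast (le_max_right _ _).trans (le_max_right (2 ^ 26) _)
  set X : ℝ := 10 * m + 1 / 2 with hX
  have hm1 : (1 : ℝ) ≤ m := by exact_mod_cast le_trans (by norm_num) hm340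
  have hmX : (m : ℝ) ≤ X := by rw [hX]; linarith
  have hX1 : (1 : ℝ) ≤ X := hm1.trans hmX
  have hX2 : (2 : ℝ) ≤ X := by linarith
  have hX0 : (0 : ℝ) < X := by linarith
  have hXδ : C₁ + C₂ + 1 ≤ X ^ δ := by
    have hA0 : 0 ≤ A := Real.rpow_nonneg (by linarith) _
    calc C₁ + C₂ + 1 = A ^ δ := by
          rw [hA, ← Real.rpow_mul (by linarith), one_div_mul_cancel hδ.ne', Real.rpow_one]
      _ ≤ X ^ δ := Real.rpow_le_rpow hA0 (hmA.trans hmX) hδ.le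
  have hψ₁ : IsAdmissibleWeight (fun u => ((b₁ u : ℝ) : ℂ)) 1 2 J (X ^ δ) := by
    have := hC₁ (X ^ δ) (by linarith)
    convert this using 2 <;> norm_num [b₁]
  have hψ₂ : IsAdmissibleWeight (fun u => ((b₂ u : ℝ) : ℂ)) (-1) 1 J (X ^ δ) := by
    have := hC₂ (X ^ δ) (by linarith)
    convert this using 2 <;> norm_num [b₂]
  have key := H X (hmX₀.trans hmX) 1 (X ^ 2) le_rfl (by nlinarith) le_rfl
    (Real.one_le_rpow hX1 (by norm_num)) 1 le_rfl squarefree_one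
    (by rw [Nat.cast_one]; exact Real.one_le_rpow hX1 (by linarith)) 1 le_rfl
    (by rw [Nat.cast_one]; exact Real.one_le_rpow hX1 hδ.le) (Nat.coprime_one_right 1) _ _ hψ₁ hψ₂
  have low := typeISum_counterexample_lower b₁ rfl rfl b₂ rfl rfl m hm340
  -- the printed right-hand side is at most `2 X^{5/8}`
  have key' : typeISum 1 1 (fun u => ((b₁ u : ℝ) : ℂ)) (fun u => ((b₂ u : ℝ) : ℂ)) X (X ^ 2) 1 ≤
      2 * X ^ (5 / 8 : ℝ) := by
    refine key.trans ?_
    simp only [Nat.cast_one, Real.one_rpow, one_mul, one_add_one_eq_two]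
    have h1 : X ^ (1 / 64 : ℝ) * X ^ (1 / 2 : ℝ) * X ^ (7 / 64 : ℝ) = X ^ (5 / 8 : ℝ) := by
      rw [← Real.rpow_add hX0, ← Real.rpow_add hX0]; norm_num
    have h2 : (1 + X / 2) ^ (7 / 64 : ℝ) ≤ X ^ (7 / 64 : ℝ) :=
      Real.rpow_le_rpow (by positivity) (by linarith) (by norm_num)
    have h3 : (0 : ℝ) ≤ X ^ (1 / 64 : ℝ) * X ^ (1 / 2 : ℝ) := by positivity
    calc X ^ (1 / 64 : ℝ) * (X ^ (1 / 2 : ℝ) * 2 * (1 + X / 2) ^ (7 / 64 : ℝ))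
        = 2 * (X ^ (1 / 64 : ℝ) * X ^ (1 / 2 : ℝ)) * (1 + X / 2) ^ (7 / 64 : ℝ) := by ring
      _ ≤ 2 * (X ^ (1 / 64 : ℝ) * X ^ (1 / 2 : ℝ)) * X ^ (7 / 64 : ℝ) := by gcongr
      _ = 2 * X ^ (5 / 8 : ℝ) := by rw [← h1]; ring
  -- contradiction for `m ≥ 2^26`
  have hXle : X ≤ 11 * m := by rw [hX]; linarith
  have h1 : (m : ℝ) / 162 ≤ (11 * m) ^ (5 / 8 : ℝ) := by
    have := low.trans key'
    have h' : X ^ (5 / 8 : ℝ) ≤ (11 * m) ^ (5 / 8 : ℝ) :=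
      Real.rpow_le_rpow hX0.le hXle (by norm_num)
    linarith
  have h2 : ((m : ℝ) / 162) ^ (8 : ℕ) ≤ ((11 * (m : ℝ)) ^ (5 / 8 : ℝ)) ^ (8 : ℕ) :=
    pow_le_pow_left₀ (by positivity) h1 8
  have h3 : ((11 * (m : ℝ)) ^ (5 / 8 : ℝ)) ^ (8 : ℕ) = (11 * (m : ℝ)) ^ (5 : ℕ) := by
    rw [← Real.rpow_natCast, ← Real.rpow_mul (by positivity),
      show ((5 : ℝ) / 8 * ((8 : ℕ) : ℝ)) = ((5 : ℕ) : ℝ) by norm_num, Real.rpow_natCast]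
  rw [h3, div_pow, div_le_iff₀ (by positivity)] at h2
  have h4 : (m : ℝ) ^ 3 ≤ 11 ^ 5 * 162 ^ 8 := by
    have hm5 : (0 : ℝ) < (m : ℝ) ^ 5 := by positivity
    have h5 : (m : ℝ) ^ 3 * (m : ℝ) ^ 5 ≤ 11 ^ 5 * 162 ^ 8 * (m : ℝ) ^ 5 := by nlinarith
    exact le_of_mul_le_mul_right h5 hm5
  have h6 : ((2 : ℝ) ^ 26) ^ 3 ≤ (m : ℝ) ^ 3 := pow_le_pow_left₀ (by positivity) (by exact_mod_cast hm26) 3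
  norm_num at h4 h6
  linarith

end Literature.NumberTheory.Sieve

end
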